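/-
Copyright: lit-balaban Phase-2 proof seat p30 (gen 25).  Statement-level skeleton of a published paper; no proof claims beyond what the
kernel checks below.
-/
import Literature.MathematicalPhysics.QuantumFieldTheory.Balaban1983to89.T4AxialGaugeSmallField
import Literature.MathematicalPhysics.QuantumFieldTheory.Balaban1983to89.B3TorusRadialSums

/-!
# [BalabanImbrieJaffe1985] §7.3 p. 326 *"by change of gauge u_k can be transformed in a local region Λ into a configuration of the form
# exp[ie_kηA], where A is smooth and small"* —
# the CENTRE-ROOTED axial (tree) gauge of [Balaban1985Averaging] p. 24 on a non-wrapping ball of the torus, in GENERAL POSITION: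
# `dist1(U^{h}(z, z+e_μ)) ≤ (Σ_{κ<μ}|z_κ − x₀,κ|)·δ ≤ (d−1)·|z − x₀|_∞·δ` for every bond of the ball, whatever the orthant of `z` relative to
# the root `x₀` — the bond deviations grow at most LINEARLY WITH THE DISTANCE FROM THE CENTRE and vanish at the centre

T. Bałaban, J. Imbrie, A. Jaffe, *Renormalization of the Higgs model: minimizers, propagators and the stability of mean field theory*,
Commun. Math. Phys. **97** (1985) 299–329 [BalabanImbrieJaffe1985], §7.3 p. 326 [PDF 28]; T. Bałaban, *Averaging operations for lattice
gauge theories*, Commun. Math. Phys. **98** (1985) 17–51 [Balaban1985Averaging], (9) p. 18, pp. 24–25.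

statement-level skeleton of published theorems with citation tags; proofs where landed; nothing here is a claim about the Yang–Mills mass gap

CITATION HEADER (lean-in-tree rule).  Part of the lit-balaban TYPED SKELETON (HOME `run/shared/lean/pub/lit-balaban/`), PHASE-2 proof seat
p30 gen 25 (unit `lit-balaban-p30-g25`; TAKING line HOME/STATUS.md 2026-08-22T22:31:47Z; free-target protocol G.5-34(d) — the residual of
item 3 of the owner's `HOME/lit-balaban-r15/C1-CLOSURE.md` §5 (owner r15, referee ref-5): *"Still free here (M/L): the D_u-derivative …
members at small non-flat u"*).  WHAT THIS FILE IS: kernel file 2 of 3 of the COVARIANT-DERIVATIVE member of [7] (1.10) for the torus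
propagator `G_k(u)` of [BalabanImbrieJaffe1985] p. 326 at non-flat small fields — the GAUGE INPUT (row **C1.Eq7.3.1-7.3.2** of
`HOME/lit-balaban-r15/ROWS-C1.md`, a located input of a located member; no head effect).  The group-theoretic word machinery
(`B7Prop1Explicit`, `B8Lemma1NonAbelian`: `hol`, `treeWord`, `ladder`, `axialFn`, `lowPart`, the SHARP TREE-GAUGE IDENTITY
`axial_bond_eq_sharp`) and its transport to the torus carrier (`T4AxialGaugeSmallField`: `castSite`, `pull`, `BoxPlaqSmall`,
`dist1_hol_ladder_le_local`, `castSite_injOn_box`) are used BY NAME; nothing of them is re-proved or modified.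

THE PRINTED TEXT (verbatim).  [BalabanImbrieJaffe1985] p. 326 [PDF 28] (as transcribed in the tree's `BIJ85ScalarPropagatorSupDecay`):
*"The propagators arising from Δ_k(u_k), under the restriction (7.3.1) on the gauge field, also satisfy the regularity and decay estimates
of [7]. In order to remain within the framework of this reference, we remark that by change of gauge u_k can be transformed in a local
region Λ into a configuration of the form exp[ie_kηA], where A is smooth and small."*  [Balaban1985Averaging] p. 24 l. −2 – p. 25 l. 3 (as
transcribed in the tree's `B8Lemma1NonAbelian`): *"V₀(x, x + e₁) = 1, |V₀(x, x + e₂) − 1| < |x₁ − y₁|α₀, …"* (the axial gauge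
`v₀(x) := V(Γ_{y,x})` rooted at `y`, (9) p. 18 for the elementary loops).

THE POINT OF THIS FILE.  The tree's torus Poincaré lemma `T4AxialGaugeSmallField.dist1_gaugeAct_axialGauge_le` roots the tree at the
CORNER `lo` of the box and needs `lo ≤ x` (T4 caveat (CORNER TREE)); its bound `(Σ_{κ<μ}|x_κ − lo_κ|)·δ` is then of the size
`(d−1)·(diameter)·δ` uniformly over the box.  The interior gradient estimate of the companion file `BIJ85ScalarPropagatorSupDecayDeriv`
needs the print's tree ROOTED AT THE CENTRE `y` of the region, where the deviation of the bond at `z` is `≤ (d−1)·|z − y|_∞·δ` —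
small NEAR the centre, whatever the orthant of `z − y`.  For that the ladder of the sharp identity must be followed through tree words
with BACKWARD letters: the new ingredients are the localisation of the base points met along a general tree word
(`disp_prefix_treeWord`: every prefix displacement lies, coordinatewise, between `0` and the target) and the elementary loop of a
backward letter (`hol_lplaqWord_false`: it is a conjugated inverse plaquette based at `x − e_κ`, so `dist1` is that of a plaquette of
the box `[min(x,y) − 1, max(x,y) + 2]`).

WHAT IS PROVED (0 `sorry`; standard axioms; every `[GaugeGroup G]`, only the interface axioms of `dist1`).
* §1 GROUP LEVEL ON `ℤ^d`: `hol_lplaqWord_false`, `dist1_hol_lplaqWord_false` (backward elementary loops are conjugated inverse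
  plaquettes); **`dist1_axial_bond_le_general`**: `BoxPlaqSmall V lo hi a`, `lo + 1 ≤ min(x,y)`, `max(x,y) + 2 ≤ hi` coordinatewise ⟹
  `dist1 (V^{y}(x, x+e_μ)) ≤ (Σ_{κ<μ}|x_κ − y_κ|)·a` for the axial gauge `V^y = (axialFn V y)·V` rooted at ANY `y`, ANY `x`;
  the count (private `l1_lowPart_le_of_abs_le`): `Σ_{κ<μ}|v_κ| ≤ (d−1)·n` when `|v_κ| ≤ n`.
* §2 TORUS CARRIER `GaugeField P j G` of `Setup`: `axialGaugeAt U lo hi y : GaugeTransf P j G` (the axial gauge function of the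
  pullback rooted at `y` on the image of the box `[lo, hi]`, `1` elsewhere; T4's `axialGauge` is `y = lo`), `axialGaugeAt_castSite`,
  `gaugeAct_axialGaugeAt_castSite` (on a non-wrapping box its action on box bonds is the `ℤ^d` gauge action), and the torus lemma in
  general position **`dist1_gaugeAct_axialGaugeAt_le`**.
* §3 THE CENTRED GAUGE OF A BALL: `lift` (integer lift of a torus site; private `castSite_lift`), **`centredGauge U x₀ R`** `:=` the axial gauge
  of the box `[x₀ − R − 2, x₀ + R + 2]` rooted at `x₀`, and **`dist1_centredGauge_le`**: if `dist1 (U(∂p)) ≤ δ` (`0 ≤ δ`) for every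
  plaquette of `T^{(j)}` and `2R + 4 < sitesPerDir j` (the ball does not wrap), then for every `z` with `|z − x₀|_∞ ≤ R` and every `μ`,
  `dist1 (U^{centredGauge}(z, z + e_μ)) ≤ (d − 1)·|z − x₀|_∞·δ` (the lift of `z` is by least residues of `z − x₀`, `|·| = cdist ≤ supDist`).

HONEST SCOPE.  (NON-WRAPPING) `2R + 4 < sitesPerDir j` is essential (T4 caveat: on a wrapping region non-contractible holonomies are
gauge invariant); nothing is claimed for the whole torus.  (HYPOTHESIS) the plaquette bound is assumed on ALL plaquettes of the torus
(the use of record: (7.3.1) holds globally); the box-local version is `dist1_gaugeAct_axialGaugeAt_le`.  (GROUP) general `GaugeGroup`;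
the `U(1)`-valued fields of [BalabanImbrieJaffe1985] enter through the cell's `U1` instance downstream (`plaqC_eq_toC_plaqHol`,
`dist1_eq_norm_toC_sub_one`), not here.  (CONSTANT) `(d−1)·|z − x₀|_∞`, not the print's `d(Λ)`; direction order of `B7Prop1Explicit.treeWord`.
Nothing here is summit progress, continuum or Clay.  Unit `lit-balaban-p30` (literature-prover-lit-balaban-p30-g25-0), HOME
`run/shared/lean/pub/lit-balaban/`, 2026-08-22.
-/

noncomputable section

open Set

namespace Literature.MathematicalPhysics.QuantumFieldTheory.BalabanImbrieJaffe1984to88.BIJ85CentredAxialGauge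

open Literature.MathematicalPhysics.QuantumFieldTheory.Balaban1983to89
open B7Prop1Explicit (Letter e e_apply disp disp_nil disp_cons disp_append hol hol_nil hol_cons stepHol stepHol_true
  stepHol_false gaugeAct hol_gaugeAct_closed treeWord disp_treeWord l1 length_treeWord plaqWord lplaqWord lplaqWord_true
  hol_lplaqWord disp_lplaqWord ladder axialFn seg seg_natCast seg_neg_natCast mem_seg)
open B8Lemma1NonAbelian (lowPart lowPart_apply l1_lowPart_eq ne_zero_of_mem_treeWord axial_bond_eq_sharp)
open B7Prop1Local (hol_plaqWord_eq)
open B11GaugeGlue (dist1_conj_inv)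
open T4AxialGaugeSmallField (BoxPlaqSmall dist1_hol_ladder_le_local castSite castSite_apply castSite_add_e pull pull_apply
  hol_pull_plaqWord_of_lt hol_pull_plaqWord_of_gt castSite_injOn_box)
open LatticeFieldCalculus (supDist)
open B3TorusRadialSums (cdist cdist_le_supDist supDist_comm)

/-! ## §1  Group level on `ℤ^d`: prefixes of the tree word, the backward plaquette loop, the sharp bound in general position -/

section GroupLevel

variable {d : ℕ}

/-- The `ν`-coordinate of the displacement of a word is the signed count of its `±e_ν` letters. [folklore] -/
private theorem disp_apply_eq_count (w : List (Letter d)) (ν : Fin d) :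
    disp w ν = (w.count (ν, true) : ℤ) - (w.count (ν, false) : ℤ) := by
  induction w with
  | nil => simp [disp_nil]
  | cons l w ih =>
    obtain ⟨κ, b⟩ := l
    rw [disp_cons, Pi.add_apply, ih, List.count_cons, List.count_cons]
    by_cases hκ : κ = ν
    · subst hκ
      cases b <;> (simp [B7Prop1Explicit.Letter.vec, e_apply]; try ring)
    · have h1 : ((κ, true) == (ν, true)) = false := by
        rw [beq_eq_false_iff_ne]; intro h; exact hκ (Prod.mk.inj h).1
      have h2 : ((κ, false) == (ν, false)) = false := by
        rw [beq_eq_false_iff_ne]; intro h; exact hκ (Prod.mk.inj h).1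
      have h3 : ((κ, true) == (ν, false)) = false := by
        rw [beq_eq_false_iff_ne]; intro h; exact hκ (Prod.mk.inj h).1
      have h4 : ((κ, false) == (ν, true)) = false := by
        rw [beq_eq_false_iff_ne]; intro h; exact hκ (Prod.mk.inj h).1
      have hv : B7Prop1Explicit.Letter.vec ((κ, b) : Letter d) ν = 0 := by
        cases b <;> simp [B7Prop1Explicit.Letter.vec, e_apply, Ne.symm hκ]
      cases b <;> simp [h1, h2, h3, h4, hv]

/-- The letters of the tree word `Γ_{0,v}` in direction `κ` all have the sign of `v_κ`. [folklore] -/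
private theorem sign_of_mem_treeWord {v : Fin d → ℤ} {l : Letter d} (hl : l ∈ treeWord v) :
    (l.2 = true ∧ 0 < v l.1) ∨ (l.2 = false ∧ v l.1 < 0) := by
  unfold treeWord at hl
  rw [List.mem_flatMap] at hl
  obtain ⟨κ, -, hκ⟩ := hl
  have h1 : l.1 = κ := mem_seg hκ
  rcases Int.eq_nat_or_neg (v κ) with ⟨n, hn | hn⟩
  · rw [hn, seg_natCast, List.mem_replicate] at hκ
    left
    refine ⟨by rw [hκ.2], ?_⟩
    rw [h1, hn]; have := hκ.1; positivity
  · rw [hn, seg_neg_natCast, List.mem_replicate] at hκ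
    right
    refine ⟨by rw [hκ.2], ?_⟩
    rw [h1, hn]; have := hκ.1; omega

/-- **Prefixes of the tree word stay in the bounding box**: if `Γ_{0,v} = w₁ ++ w₂` then every coordinate of `disp w₁` lies between `0`
and `v_ν`. [folklore] -/
private theorem disp_prefix_treeWord {v : Fin d → ℤ} {w₁ w₂ : List (Letter d)} (h : treeWord v = w₁ ++ w₂) (ν : Fin d) :
    min 0 (v ν) ≤ disp w₁ ν ∧ disp w₁ ν ≤ max 0 (v ν) := by
  have hsub : w₁.Sublist (treeWord v) := by rw [h]; exact List.sublist_append_left w₁ w₂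
  have hT := disp_apply_eq_count (treeWord v) ν
  rw [disp_treeWord] at hT
  have h1 := disp_apply_eq_count w₁ ν
  have cT := hsub.count_le (ν, true)
  have cF := hsub.count_le (ν, false)
  have hnoT : ¬ 0 < v ν → (treeWord v).count (ν, true) = 0 := fun hv =>
    List.count_eq_zero.2 fun hm => by
      rcases sign_of_mem_treeWord hm with ⟨-, h'⟩ | ⟨h', -⟩
      · exact hv h'
      · simp at h'
  have hnoF : ¬ v ν < 0 → (treeWord v).count (ν, false) = 0 := fun hv =>
    List.count_eq_zero.2 fun hm => by
      rcases sign_of_mem_treeWord hm with ⟨h', -⟩ | ⟨-, h'⟩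
      · simp at h'
      · exact hv h'
  rcases lt_trichotomy (v ν) 0 with hneg | hzero | hpos
  · have hT0 := hnoT (not_lt.2 hneg.le)
    have hw0 : w₁.count (ν, true) = 0 := Nat.eq_zero_of_le_zero (hT0 ▸ cT)
    rw [hT0] at hT; rw [hw0] at h1
    constructor <;> [skip; skip] <;> push_cast [hT0, hw0] at hT h1 cF ⊢ <;> omega
  · have hT0 := hnoT (by rw [hzero]; exact lt_irrefl 0)
    have hF0 := hnoF (by rw [hzero]; exact lt_irrefl 0)
    have hw0 : w₁.count (ν, true) = 0 := Nat.eq_zero_of_le_zero (hT0 ▸ cT)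
    have hw1 : w₁.count (ν, false) = 0 := Nat.eq_zero_of_le_zero (hF0 ▸ cF)
    rw [hw0, hw1] at h1
    constructor <;> [skip; skip] <;> push_cast at h1 ⊢ <;> omega
  · have hF0 := hnoF (not_lt.2 hpos.le)
    have hw1 : w₁.count (ν, false) = 0 := Nat.eq_zero_of_le_zero (hF0 ▸ cF)
    rw [hF0] at hT; rw [hw1] at h1
    constructor <;> [skip; skip] <;> push_cast [hF0, hw1] at hT h1 cT ⊢ <;> omega

variable {G : Type*} [GaugeGroup G]

/-- The elementary loop of a BACKWARD letter `−e_κ` in the ladder of [Balaban1985Averaging] pp. 24–25 is the inverse of the plaquette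
`∂p` with lower corner `x − e_κ`, conjugated: `V([x; −e_κ, +e_μ, +e_κ, −e_μ]) = V(x−e_κ,x)⁻¹·V(∂p(x−e_κ; κ, μ))⁻¹·V(x−e_κ,x)`.
[cite: Balaban1985Averaging, (9) p.18] -/
theorem hol_lplaqWord_false (V : (Fin d → ℤ) → Fin d → G) (x : Fin d → ℤ) (κ μ : Fin d) :
    hol V x (lplaqWord ((κ, false) : Letter d) μ) =
      (V (x - e κ) κ)⁻¹ * (hol V (x - e κ) (plaqWord κ μ))⁻¹ * V (x - e κ) κ := by
  rw [hol_lplaqWord, hol_plaqWord_eq, stepHol_false, stepHol_false, B7Prop1Explicit.Letter.vec_false]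
  have h1 : x - e κ + e κ = x := sub_add_cancel x (e κ)
  have h2 : x + e μ - e κ = x - e κ + e μ := by abel
  have h3 : x + -e κ = x - e κ := by abel
  rw [h1, h2, h3]
  group

/-- … hence its deviation from `1` is that of the plaquette variable (`dist1` is conjugation- and inversion-invariant).
[cite: Balaban1985Averaging, (9) p.18] -/
theorem dist1_hol_lplaqWord_false (V : (Fin d → ℤ) → Fin d → G) (x : Fin d → ℤ) (κ μ : Fin d) :
    dist1 (hol V x (lplaqWord ((κ, false) : Letter d) μ)) = dist1 (hol V (x - e κ) (plaqWord κ μ)) := by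
  rw [hol_lplaqWord_false, dist1_conj_inv, GaugeGroup.dist1_inv]

/-- **THE SHARP TREE-GAUGE BOND BOUND IN GENERAL POSITION** (the centre-rooted version of `T4AxialGaugeSmallField.dist1_axial_bond_le_sharp`,
which needs `y ≤ x`): in the axial gauge `V^y = (axialFn V y)·V` rooted at ANY `y`, for ANY `x` (every orthant relative to `y`),
`dist1 (V^y(x, x + e_μ)) ≤ (Σ_{κ<μ}|x_κ − y_κ|)·a`, provided `|V(∂p) − 1| ≤ a` on the plaquettes of a box `[lo, hi]` containing
`[min(x,y) − 1, max(x,y) + 2]` coordinatewise ([Balaban1985Averaging] p. 24 l. −2 – p. 25 l. 3: *"V₀(x, x + e₁) = 1, |V₀(x, x + e₂) − 1| <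
|x₁ − y₁|α₀, …"*).  Mechanism: B8's sharp identity `axial_bond_eq_sharp` (any position) + T4's ladder estimate; the new ingredient is
the localisation of the elementary plaquettes met by the ladder when the tree word has backward letters (`disp_prefix_treeWord`,
`dist1_hol_lplaqWord_false`). [cite: Balaban1985Averaging, pp.24–25] -/
theorem dist1_axial_bond_le_general (V : (Fin d → ℤ) → Fin d → G) {lo hi : Fin d → ℤ} {a : ℝ} (hP : BoxPlaqSmall V lo hi a)
    (y x : Fin d → ℤ) (μ : Fin d) (hlo : ∀ κ, lo κ + 1 ≤ min (x κ) (y κ)) (hhi : ∀ κ, max (x κ) (y κ) + 2 ≤ hi κ) :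
    dist1 (gaugeAct (axialFn V y) V x μ) ≤ l1 (lowPart μ (x - y)) * a := by
  set V₀ := gaugeAct (axialFn V y) V with hV₀
  set Lo : Fin d → ℤ := lowPart μ (x - y) with hLo
  set w : Fin d → ℤ := x - Lo with hw
  set Q : List (Letter d) := treeWord Lo with hQ
  have hid := axial_bond_eq_sharp V y x μ
  rw [← hV₀, ← hLo, ← hw, ← hQ] at hid
  have hQμ : ∀ l ∈ Q, l.1 ≠ μ := by
    intro l hl hlμ
    have h0 := ne_zero_of_mem_treeWord hl
    rw [hlμ, hLo, lowPart_apply, if_neg (lt_irrefl μ)] at h0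
    exact h0 rfl
  -- every base point met along the ladder lies in `[min(x,y), max(x,y)]`
  have hbase : ∀ (w₁ w₂ : List (Letter d)), Q = w₁ ++ w₂ →
      ∀ κ, lo κ + 1 ≤ w κ + disp w₁ κ ∧ w κ + disp w₁ κ + 2 ≤ hi κ := by
    intro w₁ w₂ hsplit κ
    have hb := disp_prefix_treeWord hsplit κ
    have h1 := hlo κ
    have h2 := hhi κ
    simp only [hw, hLo, Pi.sub_apply, lowPart_apply] at hb ⊢
    split_ifs at hb ⊢ with hκ <;> omega
  have hP' : ∀ (w₁ w₂ : List (Letter d)) (l : Letter d), Q = w₁ ++ l :: w₂ →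
      dist1 (hol V₀ (w + disp w₁) (lplaqWord l μ)) ≤ a := by
    intro w₁ w₂ l hsplit
    have hl : l ∈ Q := by rw [hsplit]; simp
    have hκμ : l.1 ≠ μ := hQμ l hl
    have hb := hbase w₁ (l :: w₂) hsplit
    obtain ⟨κ, s⟩ := l
    rw [hV₀, hol_gaugeAct_closed _ _ _ _ (disp_lplaqWord _ _), GaugeGroup.dist1_conj]
    cases s
    · rw [dist1_hol_lplaqWord_false]
      refine hP _ κ μ hκμ (fun ν => ?_) (fun ν => ?_)
      · have := (hb ν).1
        simp only [Pi.sub_apply, Pi.add_apply, e_apply]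
        split_ifs <;> omega
      · have := (hb ν).2
        simp only [Pi.sub_apply, Pi.add_apply, e_apply]
        split_ifs <;> omega
    · rw [lplaqWord_true]
      refine hP _ κ μ hκμ (fun ν => ?_) (fun ν => ?_)
      · have := (hb ν).1
        simp only [Pi.add_apply]
        omega
      · have := (hb ν).2
        simp only [Pi.add_apply, e_apply]
        split_ifs <;> omega
  have hlad := dist1_hol_ladder_le_local V₀ μ Q w hQμ hP'
  rw [hid, dist1_conj_inv]
  refine hlad.trans (le_of_eq ?_)
  rw [hQ, length_treeWord]

/-- The count in general position: `Σ_{κ<μ}|v_κ| ≤ (d − 1)·n` when `|v_κ| ≤ n` for all `κ`. [folklore] -/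
private theorem l1_lowPart_le_of_abs_le (μ : Fin d) {v : Fin d → ℤ} {n : ℕ} (hn : ∀ κ, |v κ| ≤ n) :
    l1 (lowPart μ v) ≤ (d - 1) * n := by
  rw [l1_lowPart_eq]
  calc ∑ κ, (if κ < μ then (v κ).natAbs else 0)
      ≤ ∑ κ : Fin d, (if κ < μ then n else 0) := Finset.sum_le_sum fun κ _ => by
        split_ifs
        · have h1 := hn κ
          have : ((v κ).natAbs : ℤ) ≤ n := by rw [Int.natCast_natAbs]; exact h1
          exact_mod_cast this
        · exact le_rfl
    _ = (μ : ℕ) * n := by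
        rw [Finset.sum_ite, Finset.sum_const_zero, add_zero, Finset.sum_const, smul_eq_mul]
        congr 1
        rw [show (Finset.univ.filter fun κ : Fin d => κ < μ) = Finset.Iio μ by ext κ; simp, Fin.card_Iio]
    _ ≤ (d - 1) * n := Nat.mul_le_mul_right _ (by have := μ.isLt; omega)

end GroupLevel

/-! ## §2  Transport to the torus carrier: the axial gauge of a non-wrapping box ROOTED AT AN ARBITRARY POINT `y` -/

section Torus

variable {P : Params} {j : ℕ} {G : Type*}

open Classical in
/-- THE AXIAL GAUGE TRANSFORMATION OF THE BOX `[lo, hi]` ROOTED AT `y` (T4's `axialGauge` is the case `y = lo`): `axialFn (pull U) y x` at the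
image of a box point `x`, `1` off the image of the box ([Balaban1985Averaging] p. 24 *"v₀(x) := V(Γ_{y,x})"*).
[cite: Balaban1985Averaging, p.24] -/
def axialGaugeAt [Group G] (U : GaugeField P j G) (lo hi y : Fin P.d → ℤ) : GaugeTransf P j G := fun s =>
  if h : ∃ x : Fin P.d → ℤ, lo ≤ x ∧ x ≤ hi ∧ (castSite x : Balaban1983to89.Site P j) = s then axialFn (pull U) y (Classical.choose h) else 1

variable [GaugeGroup G]

/-- On a non-wrapping box the torus gauge transformation IS the `ℤ^d` axial gauge function rooted at `y`. [cite: Balaban1985Averaging, p.24] -/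
theorem axialGaugeAt_castSite (U : GaugeField P j G) {lo hi : Fin P.d → ℤ} (y : Fin P.d → ℤ)
    (hN : ∀ κ, hi κ - lo κ < P.sitesPerDir j) {x : Fin P.d → ℤ} (hx : lo ≤ x) (hx' : x ≤ hi) :
    axialGaugeAt U lo hi y (castSite x) = axialFn (pull U) y x := by
  have h : ∃ x' : Fin P.d → ℤ, lo ≤ x' ∧ x' ≤ hi ∧ (castSite x' : Balaban1983to89.Site P j) = castSite x := ⟨x, hx, hx', rfl⟩
  rw [axialGaugeAt, dif_pos h]
  obtain ⟨h1, h2, h3⟩ := Classical.choose_spec h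
  rw [castSite_injOn_box hN h1 h2 hx hx' h3]

/-- The torus gauge action of `axialGaugeAt` on a bond of the box is the `ℤ^d` gauge action of `axialFn` on the pullback.
[cite: Balaban1985Averaging, p.24] -/
theorem gaugeAct_axialGaugeAt_castSite (U : GaugeField P j G) {lo hi : Fin P.d → ℤ} (y : Fin P.d → ℤ)
    (hN : ∀ κ, hi κ - lo κ < P.sitesPerDir j) {x : Fin P.d → ℤ} {μ : Fin P.d} (hx : lo ≤ x) (hxμ : x + e μ ≤ hi) :
    GaugeField.gaugeAct (axialGaugeAt U lo hi y) U ⟨castSite x, μ⟩ = gaugeAct (axialFn (pull U) y) (pull U) x μ := by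
  have hx' : x ≤ hi := (le_add_of_nonneg_right (B8Lemma1NonAbelian.e_nonneg μ)).trans hxμ
  have hlo' : lo ≤ x + e μ := hx.trans (le_add_of_nonneg_right (B8Lemma1NonAbelian.e_nonneg μ))
  simp only [GaugeField.gaugeAct, PBond.tgt, gaugeAct, pull_apply]
  rw [← castSite_add_e, axialGaugeAt_castSite U y hN hx hx', axialGaugeAt_castSite U y hN hlo' hxμ]

/-- **THE TORUS POINCARÉ LEMMA ROOTED AT `y`, GENERAL POSITION**: plaquette-small `≤ a` on the box `[lo, hi]` (pullback hypothesis
`BoxPlaqSmall`) ⟹ every bond `⟨x, x + e_μ⟩` with `[min(x,y) − 1, max(x,y) + 2] ⊆ [lo, hi]` satisfies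
`dist1 (U^{axialGaugeAt}(b)) ≤ (Σ_{κ<μ}|x_κ − y_κ|)·a`. [cite: Balaban1985Averaging, pp.24–25] -/
theorem dist1_gaugeAct_axialGaugeAt_le (U : GaugeField P j G) {lo hi : Fin P.d → ℤ} {a : ℝ} (hP : BoxPlaqSmall (pull U) lo hi a)
    (hN : ∀ κ, hi κ - lo κ < P.sitesPerDir j) (y : Fin P.d → ℤ) {x : Fin P.d → ℤ} (μ : Fin P.d)
    (hlo : ∀ κ, lo κ + 1 ≤ min (x κ) (y κ)) (hhi : ∀ κ, max (x κ) (y κ) + 2 ≤ hi κ) :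
    dist1 (GaugeField.gaugeAct (axialGaugeAt U lo hi y) U ⟨castSite x, μ⟩) ≤ l1 (lowPart μ (x - y)) * a := by
  have hx : lo ≤ x := fun κ => by have := hlo κ; have := min_le_left (x κ) (y κ); linarith
  have hxμ : x + e μ ≤ hi := fun κ => by
    have := hhi κ; have := le_max_left (x κ) (y κ)
    simp only [Pi.add_apply, e_apply]; split_ifs <;> linarith
  rw [gaugeAct_axialGaugeAt_castSite U y hN hx hxμ]
  exact dist1_axial_bond_le_general (pull U) hP y x μ hlo hhi

end Torus

/-! ## §3  The centred gauge of a torus ball and the `|·|_∞` form of the bound -/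

section Centred

variable {P : Params} {j : ℕ} {G : Type*} [GaugeGroup G]

/-- The canonical integer lift of a torus site (coordinates `val`). [folklore] -/
def lift (x₀ : Balaban1983to89.Site P j) : Fin P.d → ℤ := fun κ => ((x₀ κ).val : ℤ)

/-- `castSite (lift x₀) = x₀`. [folklore] -/
private theorem castSite_lift (x₀ : Balaban1983to89.Site P j) : (castSite (lift x₀) : Balaban1983to89.Site P j) = x₀ := by
  funext κ
  simp [lift, castSite_apply]

/-- kernel: the circular distance is the absolute value of the least residue: `|valMinAbs m| = cdist m`. [folklore] -/
private theorem natAbs_valMinAbs_eq_cdist {n : ℕ} [NeZero n] (m : ZMod n) : m.valMinAbs.natAbs = cdist m := by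
  rw [ZMod.valMinAbs_natAbs_eq_min, cdist, ZMod.neg_val]
  split_ifs with h
  · subst h; simp
  · rfl

/-- **THE CENTRED GAUGE OF A TORUS BALL** around `x₀` of sup-radius `R`: the axial gauge of the box `[x₀ − R − 2, x₀ + R + 2]` (integer lift)
rooted at its centre `x₀`. [cite: BalabanImbrieJaffe1985, p.326; Balaban1985Averaging, p.24] -/
def centredGauge (U : GaugeField P j G) (x₀ : Balaban1983to89.Site P j) (R : ℕ) : GaugeTransf P j G :=
  axialGaugeAt U (fun κ => lift x₀ κ - (R + 2)) (fun κ => lift x₀ κ + (R + 2)) (lift x₀)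

/-- The pullback box hypothesis from a NON-STRICT plaquette bound on the torus (T4's `boxPlaqSmall_pull` with `≤`; both orientations
by `dist1_inv`). [folklore] -/
private theorem boxPlaqSmall_pull_of_le (U : GaugeField P j G) (lo hi : Fin P.d → ℤ) {δ : ℝ}
    (hU : ∀ p : Balaban1983to89.Plaq P j, dist1 (GaugeField.plaqHol U p) ≤ δ) : BoxPlaqSmall (pull U) lo hi δ := by
  intro z κ μ hκμ _ _
  rcases lt_or_gt_of_ne hκμ with h | h
  · rw [hol_pull_plaqWord_of_lt U z h]; exact hU _
  · rw [hol_pull_plaqWord_of_gt U z h, GaugeGroup.dist1_inv]; exact hU _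

/-- **p. 326, THE LOCAL CHANGE OF GAUGE WITH LINEAR GROWTH FROM THE CENTRE**: if `dist1 (U(∂p)) ≤ δ` for every plaquette of the torus
`T^{(j)}` and the ball of sup-radius `R` around `x₀` does not wrap (`2R + 4 < sitesPerDir j`), then in the centred gauge `h = centredGauge U x₀ R`
EVERY bond `b = ⟨z, z + e_μ⟩` with `|z − x₀|_∞ ≤ R` satisfies `dist1 (U^h(b)) ≤ (d − 1)·|z − x₀|_∞·δ` — the bond deviations grow at most
linearly with the sup-distance from the centre (and vanish at the centre).  This is the *"change of gauge … in a local region Λ"* of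
[BalabanImbrieJaffe1985] p. 326 in the tree gauge of [Balaban1985Averaging] p. 24, for a general gauge group with an invariant distance
(`GaugeGroup`). [cite: BalabanImbrieJaffe1985, p.326; Balaban1985Averaging, pp.24–25] -/
theorem dist1_centredGauge_le (U : GaugeField P j G) {δ : ℝ} (hδ : 0 ≤ δ) (hU : ∀ p : Balaban1983to89.Plaq P j, dist1 (GaugeField.plaqHol U p) ≤ δ)
    (x₀ : Balaban1983to89.Site P j) {R : ℕ} (hR : 2 * R + 4 < P.sitesPerDir j) (z : Balaban1983to89.Site P j) (hz : supDist x₀ z ≤ R) (μ : Fin P.d) :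
    dist1 (GaugeField.gaugeAct (centredGauge U x₀ R) U ⟨z, μ⟩) ≤ ((P.d - 1 : ℕ) : ℝ) * (supDist x₀ z : ℝ) * δ := by
  -- the integer lift of `z` by least residues of `z − x₀`
  set s : Fin P.d → ℤ := fun κ => (z κ - x₀ κ).valMinAbs with hs
  set zi : Fin P.d → ℤ := lift x₀ + s with hzi
  have hcast : (castSite zi : Balaban1983to89.Site P j) = z := by
    funext κ
    simp only [hzi, hs, lift, castSite_apply, Pi.add_apply, Int.cast_add, Int.cast_natCast, ZMod.natCast_zmod_val,
      ZMod.coe_valMinAbs]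
    abel
  have habs : ∀ κ, |s κ| ≤ ((supDist x₀ z : ℕ) : ℤ) := fun κ => by
    have h1 : (s κ).natAbs ≤ supDist x₀ z := by
      rw [hs, natAbs_valMinAbs_eq_cdist, supDist_comm]
      exact cdist_le_supDist z x₀ κ
    rw [← Int.natCast_natAbs]; exact_mod_cast h1
  have hsz : ∀ κ, |s κ| ≤ (R : ℤ) := fun κ => (habs κ).trans (by exact_mod_cast hz)
  have hN : ∀ κ, (lift x₀ κ + (R + 2)) - (lift x₀ κ - (R + 2)) < P.sitesPerDir j := fun κ => by
    have : ((2 * R + 4 : ℕ) : ℤ) < P.sitesPerDir j := by exact_mod_cast hR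
    push_cast at this
    linarith
  have hlo : ∀ κ, (lift x₀ κ - (R + 2)) + 1 ≤ min (zi κ) (lift x₀ κ) := fun κ => by
    have h1 := hsz κ
    simp only [hzi, Pi.add_apply]
    rw [abs_le] at h1
    refine le_min ?_ ?_ <;> linarith
  have hhi : ∀ κ, max (zi κ) (lift x₀ κ) + 2 ≤ lift x₀ κ + (R + 2) := fun κ => by
    have h1 := hsz κ
    simp only [hzi, Pi.add_apply]
    rw [abs_le] at h1
    have : max (lift x₀ κ + s κ) (lift x₀ κ) ≤ lift x₀ κ + R := max_le (by linarith) (by linarith)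
    linarith
  have hmain := dist1_gaugeAct_axialGaugeAt_le U (boxPlaqSmall_pull_of_le U _ _ hU) hN (lift x₀) μ hlo hhi
  rw [hcast] at hmain
  unfold centredGauge
  refine hmain.trans ?_
  have hl1 : l1 (lowPart μ (zi - lift x₀)) ≤ (P.d - 1) * supDist x₀ z := by
    have : zi - lift x₀ = s := by rw [hzi]; abel
    rw [this]
    exact l1_lowPart_le_of_abs_le μ habs
  have : (l1 (lowPart μ (zi - lift x₀)) : ℝ) ≤ ((P.d - 1 : ℕ) : ℝ) * (supDist x₀ z : ℝ) := by exact_mod_cast hl1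
  exact mul_le_mul_of_nonneg_right this hδ

end Centred

end Literature.MathematicalPhysics.QuantumFieldTheory.BalabanImbrieJaffe1984to88.BIJ85CentredAxialGauge
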